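import Summits.ResolutionOfSingularities.ResolutionOfSingularities.Theorems.FrobeniusClosingPatchingRelPerfectDepthFlagPrephaseBad
import Literature.AlgebraicGeometry.Resolution.DivisorialPart
import Literature.AlgebraicGeometry.Resolution.OrderSemicontinuity
import HarnessLib

/-!
# Crux `PatchingRelPerfect` (stmt-ResolutionOfSingularities-16161), chain W5.2 — T6-E1b residual `LegalScopedDivisorReduction₃`,
# PHASE 2 closer (2b), spec D2: the MEASURE of the curve-move loop and its drop

[OURS · L1 W5.2 · res-L1-w52-lead-1 g5, hand #3b; spec `L/res-L1-w52-lead-1/PHASE2-STEPB-SPEC.md` D2] Replaces the role of NO printed item;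
NOT a statement of the manuscript under review; fact-free.

The curve-move loop of the separation game terminates by the TOTAL TRACE DEGREE `Φ(T) = Σ_{ζ ∈ divisorialPoints T} ord_ζ T` (sum over the
finitely many codimension-one points of the trace support on the integral Noetherian host; pattern of res-type-049's `DepthFlagPeel.peel_loop`).
Along one curve move the host changes by an ISOMORPHISM `π : X′ → X` and the trace by `T𝒪 = 𝓟_ζ𝒪 · T′` (`HostStateN.curve_move`):
orders drop by one over `ζ` and are unchanged at the other codimension-one points, so `Φ(T′) + 1 ≤ Φ(T)` — a finite-sum transport along
the injective `π` (`Finset.sum_image`, `Finset.sum_le_sum_of_subset`):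

* `measure_drop` — the inequality, from the three order facts delivered by `curve_move`.

AI-written; AI review is weaker than expert review.

## References
* V. Cossart, O. Piltant, J. Algebra 320 (2008), proof of Prop. 4.2 (the divisorial points). [CossartPiltant2008]
-/

-- `Summit.<Summit>.<Sub>.Theorems` with `Sub = Summit` (single-conjunct summit, D-0017)
set_option linter.dupNamespace false

noncomputable section

open CategoryTheory CategoryTheory.Limits AlgebraicGeometry TopologicalSpace IsLocalRing
open Literature.AlgebraicGeometry.Resolution Scheme.IdealSheafData

namespace Summit.ResolutionOfSingularities.ResolutionOfSingularities.Theorems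

universe u

namespace DepthLegal

/-- [OURS · L1 W5.2] **THE MEASURE DROPS under a curve move.** `X, X′` integral Noetherian, `π : X′ → X` with isomorphic stalk maps and
injective on points (an isomorphism), `T ≠ ⊥` on `X`, `T′ ≠ ⊥` on `X′`, `ζ` a divisorial point of `T`; if `Supp T′ ⊆ π⁻¹ Supp T`, the order
of `T′` over `ζ` is one less than `ord_ζ T`, and at every other codimension-one point it equals the order of `T` below, then
`Σ_{divisorialPoints T′} ord T′ + 1 ≤ Σ_{divisorialPoints T} ord T`. [cite: CossartPiltant2008, proof of Prop. 4.2] -/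
theorem measure_drop {X X' : Scheme.{u}} [IsIntegral X] [IsNoetherian X] [IsIntegral X'] [IsNoetherian X'] (π : X' ⟶ X)
    [∀ x', IsIso (π.stalkMap x')] (hinj : Function.Injective π.base)
    {T : X.IdealSheafData} {T' : X'.IdealSheafData} (hT : T ≠ ⊥) (hT' : T' ≠ ⊥) {ζ : X} (hζ : ζ ∈ divisorialPoints T)
    (hsupp : ∀ y' : X', y' ∈ T'.support → π y' ∈ T.support)
    (hself : ∀ ζ' : X', π ζ' = ζ → idealOrder T' ζ' + 1 = idealOrder T ζ)
    (hne : ∀ y' : X', Order.coheight (π y') = 1 → ζ ≠ π y' → idealOrder T' y' = idealOrder T (π y')) :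
    (∑ y' ∈ (finite_divisorialPoints hT').toFinset, (idealOrder T' y').toNat) + 1 ≤
      ∑ y ∈ (finite_divisorialPoints hT).toFinset, (idealOrder T y).toNat := by
  classical
  set s' := (finite_divisorialPoints hT').toFinset with hs'
  set s := (finite_divisorialPoints hT).toFinset with hs
  -- the comparison function on `X`: the order of `T`, minus one at `ζ`
  set h : X → ℕ := fun y => (idealOrder T y).toNat - if y = ζ then 1 else 0 with hh
  -- (1) divisorial points of `T′` go to divisorial points of `T`
  have hmem : ∀ y' ∈ s', π y' ∈ s := by
    intro y' hy'
    rw [hs', Set.Finite.mem_toFinset, mem_divisorialPoints_iff] at hy'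
    rw [hs, Set.Finite.mem_toFinset, mem_divisorialPoints_iff]
    exact ⟨hsupp y' hy'.1, by rw [DepthFlagBad.coheight_eq_of_isIso_stalkMap π y']; exact hy'.2⟩
  -- (2) termwise: `ord T′ y′ ≤ h (π y′)`
  have hterm : ∀ y' ∈ s', (idealOrder T' y').toNat ≤ h (π y') := by
    intro y' hy'
    have hy'1 : Order.coheight (π y') = 1 := by
      rw [hs', Set.Finite.mem_toFinset, mem_divisorialPoints_iff] at hy'
      rw [DepthFlagBad.coheight_eq_of_isIso_stalkMap π y']; exact hy'.2
    obtain ⟨a, ha⟩ := exists_idealOrder_eq_natCast hT' y'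
    by_cases hyζ : π y' = ζ
    · obtain ⟨b, hb⟩ := exists_idealOrder_eq_natCast hT ζ
      have h1 := hself y' hyζ
      rw [ha, hb] at h1
      have hab : a + 1 = b := by exact_mod_cast h1
      simp only [hh, hyζ, if_true, ha, hb, ENat.toNat_coe]
      omega
    · have h1 := hne y' hy'1 (Ne.symm hyζ)
      simp only [hh, hyζ, if_false, Nat.sub_zero, h1, le_refl]
  -- (3) sum over `s′` ≤ sum of `h` over the image ≤ sum of `h` over `s`
  have hle1 : ∑ y' ∈ s', (idealOrder T' y').toNat ≤ ∑ y' ∈ s', h (π y') := Finset.sum_le_sum hterm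
  have hle2 : ∑ y' ∈ s', h (π y') = ∑ y ∈ s'.image π.base, h y := by
    rw [Finset.sum_image fun a _ b _ hab => hinj hab]
  have hle3 : ∑ y ∈ s'.image π.base, h y ≤ ∑ y ∈ s, h y :=
    Finset.sum_le_sum_of_subset fun y hy => by
      obtain ⟨y', hy', rfl⟩ := Finset.mem_image.mp hy
      exact hmem y' hy'
  -- (4) `Σ_s h + 1 = Σ_s ord T` since `ζ ∈ s` carries order `≥ 1`
  have hζs : ζ ∈ s := by rw [hs, Set.Finite.mem_toFinset]; exact hζ
  have hζ1 : 1 ≤ (idealOrder T ζ).toNat := by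
    obtain ⟨b, hb⟩ := exists_idealOrder_eq_natCast hT ζ
    have h1 : (1 : ℕ∞) ≤ idealOrder T ζ := (one_le_idealOrder_iff T ζ).mpr hζ.1
    rw [hb] at h1 ⊢
    simp only [ENat.toNat_coe]
    exact_mod_cast h1
  have hsum : ∑ y ∈ s, h y + 1 = ∑ y ∈ s, (idealOrder T y).toNat := by
    have e1 : ∑ y ∈ s, (idealOrder T y).toNat = ∑ y ∈ s, (h y + if y = ζ then 1 else 0) := by
      refine Finset.sum_congr rfl fun y hy => ?_
      by_cases hyζ : y = ζ
      · subst hyζ; simp only [hh, if_true]; omega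
      · simp only [hh, hyζ, if_false]; omega
    rw [e1, Finset.sum_add_distrib, Finset.sum_ite_eq' s ζ (fun _ => 1), if_pos hζs]
  calc (∑ y' ∈ s', (idealOrder T' y').toNat) + 1 ≤ ∑ y ∈ s, h y + 1 := by
        have := hle1.trans (hle2.le.trans hle3); omega
    _ = ∑ y ∈ s, (idealOrder T y).toNat := hsum

end DepthLegal

end Summit.ResolutionOfSingularities.ResolutionOfSingularities.Theorems

end
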